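import Literature.Probability.Percolation.KSTPeriodicArmDuality
import Literature.Probability.Percolation.KSTPeriodicBridges
import Literature.Probability.Percolation.KSTPeriodicTopologyII
import HarnessLib

/-!
# KST-type RSW for periodic measures: discharges of the named statements

Topic `Literature/Probability/Percolation`. The named statements (`def … : Prop`) of
`KSTPeriodicStatements.lean` are proved one by one in the files `KSTPeriodic*.lean`, which import
the statements file; this sibling file (append-only) assembles the resulting unconditional
discharges `theorem <Name>_holds : <Name>` (the duality input `ArmDuality` is already the
unconditional theorem `armDuality` of `KSTPeriodicArmDuality.lean`).

* `CorridorA_holds` — the corridor lemma with a horizontal crosser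
  [KohlerSchindlerTassion2023, §4.2, Lemma 2 with Remark 1]: `corridorA_of_armDuality`
  (`KSTPeriodicCorridor.lean`) fed with `armDuality`.
* `CorridorB_holds` — the corridor lemma as printed (vertical crosser, walls tied to the left and
  right sides) [KohlerSchindlerTassion2023, §4.2, Lemma 2]: `corridorB_of_armDuality` fed with
  `armDuality`.
* `BridgesGiveCrossings_holds` — Lemma 1(i),(iii) in weak periodic form (bridges give long
  crossings) [KohlerSchindlerTassion2023, §3, Lemma 1(i),(iii) and Comment 1]:
  `bridgesGiveCrossings_of` (`KSTPeriodicBridges.lean`) fed with the two planar inputs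
  `archesMeet`, `partsToSegmentsMeet` (`KSTPeriodicTopologyII.lean`), so the
  assembly `weakPeriodicRSW_of` needs only its four remaining steps.

* `TopSideToLeftMeetsTB_holds`, `TopSideToRightMeetsTB_holds` — the folklore planar inputs of
  the corridor construction (a walk from the top side of a box to its left, resp. right, column
  meets every top–bottom walk of the box whose top endpoint it separates; discrete Jordan curve
  theorem, Kesten 1982 §2.2, Bollobás–Riordan 2006 Ch. 3): the theorems `topSideToLeftMeetsTB`,
  `topSideToRightMeetsTB` of `KSTPeriodicTopology.lean` (hook extensions outside the box +
  `exists_mem_support_of_crossing`).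

## References

* [KohlerSchindlerTassion2023] L. Köhler-Schindler, V. Tassion, *Crossing probabilities for
  planar percolation*, Duke Math. J. 172 (2023) 809–838, arXiv:2011.04618, §1 (Duality),
  §3 (Lemma 1), §4.2 (Lemma 2, Remark 1).
* H. Kesten, *Percolation theory for mathematicians*, Birkhäuser (1982), §2.2.
* B. Bollobás, O. Riordan, *Percolation*, Cambridge Univ. Press (2006), Ch. 3.
-/

namespace Literature.Probability.Percolation

noncomputable section

namespace KSTPeriodic

/-- **Corridor lemma, horizontal crosser, holds** ([KohlerSchindlerTassion2023, §4.2, Lemma 2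
with Remark 1]); proved as `corridorA_of_armDuality` from `armDuality`.
[cite: KohlerSchindlerTassion2023, Lemma 2 and Remark 1] -/
theorem CorridorA_holds : CorridorA :=
  corridorA_of_armDuality armDuality

/-- **Corridor lemma (as printed: vertical crosser) holds** ([KohlerSchindlerTassion2023, §4.2,
Lemma 2]: every top–bottom path of `S` avoiding the two walls `W ∪ W'` contains a corridor path);
proved as `corridorB_of_armDuality` from `armDuality`. [cite: KohlerSchindlerTassion2023, Lemma 2] -/
theorem CorridorB_holds : CorridorB :=
  corridorB_of_armDuality armDuality

/-- **Lemma 1(i),(iii), weak periodic form, holds** ([KohlerSchindlerTassion2023, §3, Lemma 1]: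
for every `b₀ > 0` and integer aspect ratio `ρ ≥ 1` there is `c₀ > 0` such that for every
admissible measure carried by lattice configurations and every scale `n ≥ 1` divisible by `768k`,
a bridge probability `≥ b₀` at scale `n` forces `μ(𝓒_t(ρ n, n)) ≥ c₀`); proved as
`bridgesGiveCrossings_of` (constant `c₀ = (b₀/5)^(48ρ+2)`) from the planar inputs
`archesMeet` and `partsToSegmentsMeet` (`KSTPeriodicTopologyII.lean`).
[cite: KohlerSchindlerTassion2023, Lemma 1(i),(iii) and Comment 1] -/
theorem BridgesGiveCrossings_holds : ∀ k t : ℕ, BridgesGiveCrossings k t :=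
  fun _ _ => bridgesGiveCrossings_of archesMeet partsToSegmentsMeet

/-- Discharge of the named fact `TopSideToLeftMeetsTB` (by `topSideToLeftMeetsTB`,
`KSTPeriodicTopology.lean`): in the box `[L,R] × [B,T]`, a walk from a top-side vertex lying
strictly to the right of the top endpoint of a top–bottom walk `γ` to the left column meets `γ`.
(Discrete Jordan curve theorem; Kesten 1982, §2.2; Bollobás–Riordan 2006, Ch. 3.) [folklore] -/
theorem TopSideToLeftMeetsTB_holds : TopSideToLeftMeetsTB := topSideToLeftMeetsTB

/-- Discharge of the named fact `TopSideToRightMeetsTB` (by `topSideToRightMeetsTB`,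
`KSTPeriodicTopology.lean`): the mirror image — a walk from a top-side vertex strictly to the
left of the top endpoint of a top–bottom walk `γ` to the right column meets `γ`.
(Discrete Jordan curve theorem; Kesten 1982, §2.2; Bollobás–Riordan 2006, Ch. 3.) [folklore] -/
theorem TopSideToRightMeetsTB_holds : TopSideToRightMeetsTB := topSideToRightMeetsTB

end KSTPeriodic

end

end Literature.Probability.Percolation
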